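import Summits.ABC.IUTFork.DAGC312o
import Summits.ABC.IUTFork.DAGC312b
import Summits.ABC.IUTFork.Cor312TeamAChain
import Summits.ABC.IUTFork.Cor312StepsIviReal
import Summits.ABC.IUTFork.Cor312StepsViIxReal

/-!
# Kernel DAG index — layer C312, part p: knitting DELTA 7 — the twenty STEP NODES of the proof of Cor. 3.12 read
through TEAM A's landed per-step lemmas: nineteen discharged BY NAME under the readings of record, ONE — (xi-f) — left,
and that one is the Corollary

index v1 · abc-iut-c312-2 (filer, gen 3) per HOME/plan/KERNEL-DAG-SPEC.md v1.3 §2(e) ("a step is DISCHARGED only if c312-2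
proves `Step.<s>.Holds (locusNode pending) O` for every reading `O` it has typed or records by name which reading grants it") and
§4 rule (3) ("`h312` is replaced by `(hThm311 …) (hSteps : the undischarged Step nodes …)` — so at every moment the apex displays
exactly which printed items stand between the kernel and abc, BY NAME"). APPEND-ONLY: one new OBSERVATION reading and theorems;
nothing filed earlier is redefined. The loci reading of record stays `lociReadingI S pending` (part o: 84/85 loci resolved, only
(SHE) opaque).

WHAT IS KNITTED. The Cor-3.12 strategy TEAM A (D-0067; seats abc-iut-c312-9, -10, -4, rows A-1…A-5 of HOME/plan/C312-TEAMS.md)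
landed one `Step.<s>.Holds L O` lemma per printed node over the frozen verbatim setting `Cor312.Setting` (abc-iut-c312-7), for
ANY pair of readings `(L, O)` wired to the node's contents: `Cor312StepsIviReal` (opening ¶, (i)–(v), p411659),
`Cor312StepsViIxReal` ((vi)–(ix), p412147), `Cor312StepXReal` ((x), p411096), `Cor312StepXIabcReal` ((xi-a)–(xi-c)),
`Cor312StepXIdeReal` ((xi-d), (xi-e)), `Cor312StepXIfChain` ((xi-f)–(xii), p411441), composed in `Cor312TeamAChain.teamA_chain`
(p412737). This part instantiates them AT THE READINGS OF RECORD: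

* `obsReadingA S pending P D` — the OBSERVATION READING OF RECORD for a full situation `S`, a verbatim setting `P` over it and a
  strips datum `D` (the setting's own column `S.col P.n` throughout): each of the 36 observations of `Cor312Obs` is read as TEAM A
  reads it — the real contents where TEAM A typed one (`StepEarly.UnitsInd12`, `ShiftInvariantAtInd3`, `FrobToCoric`;
  `StepX.KummerDetach`/`LogvolCoarse`/`LogvolLogLink`/`TensorMultZ`; `StepXI.LinkAsGluing`/`OutputIPLSHE`/`ValueGroupFullPoly`/
  `OnlyQualitative`/`DisplayXIc`/`HullComparable`; the six `Cor312.Setting.*Real` readings of (xi-d)/(xi-e)), and, for the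
  narrative/provenance observations TEAM A wires as PASS-THROUGHS of the loci their sentence cites (no-inflation rule of row
  A-5), the conjunction of the READING-OF-RECORD values `lociReadingI S pending c` of exactly those loci. The disputed
  observation of (xi-f), "constitutes … a construction … of `−|log(q)| ∈ ℝ_{≤ −|log(Θ)|}`" (p. 184 l. 19–29), is read
  VERBATIM AT VOLUME LEVEL as the inclusion `↑(−|log(q)|) ≤ −|log(Θ)|` of the setting's own two quantities — gen 0's
  `RealEdges.inclusion` edge (file IV) becomes the identity; this is TEAM A's LEVEL 0 (`GapGlobal` ≡ `Statement` modulo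
  `ThetaFinite`, p413284; `soundAtPilot_iff_statement`, p414839) in the index's currency. (xi-g)'s "two tautologically
  equivalent ways" is the pass-through of what it invokes; (xi-h)'s terminal observation is the kernel fact
  `nthPower_not_formal` (file IV); (xii)'s is the value of the one locus it cites (Rmk 3.6.2 (i)). A READING, recorded —
  nothing is asserted.
* DISCHARGES BY NAME (`N_IUTchIII_Cor3_12_pf_<s>_holds`): under `(lociReadingI S pending, obsReadingA S pending P D)` SIXTEEN
  step nodes hold OUTRIGHT — opening ¶, (i)–(ix), (xi-b), (xi-c), (xi-e), (xi-g), (xi-h), (xii) — each by TEAM A's lemma with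
  identity wires (the kernel content inside them: `unitsInd12_holds`, `Column.mutualCompat_of_kummerB_kummerC`,
  `valueGroupFullPoly_holds`, `onlyQualitative_holds`, `hullComparable_holds`, `sheMeansFixedValueReal_holds`, and the
  `decide`d citation structure); THREE hold under NAMED side data of the instantiation — (x) given the coarse-space properties
  of the line's data `S.D P.n` (admissibility invariance on the (Ind1)/(Ind2) generators, `MRData.LogvolInvariant`, monotonicity:
  TEAM B's rows B-2/B-4 discharge them for the real containers; `Thm311ToCor312` records they are properties of the
  INSTANTIATION, not of Thm 3.11 as typed), (xi-a) given the nonemptiness of the strip isomorphisms (Def. 3.8 (ii)'s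
  presupposition; abc-iut-L6-t2's real instances), (xi-d) given the Statement's own side clauses `ThetaFinite` ("`−|log(Θ)| ∈
  ℝ`", p. 175 l. 2–8) and `AbsLogQPos` ("`|log(q)| > 0`", p. 174 l. 13); and the header (xi) is the conjunction.
* THE ONE NODE LEFT: `N_IUTchIII_Cor3_12_pf_xi_f_iff_statement` — given the two side clauses, **the (xi-f) node under the
  readings of record IS [IUTchIII] Cor. 3.12 as typed** (`Cor312.Setting.Statement`), an `↔`. Hence `chain_of_record_iff`:
  under the readings of record and the named side data, the twenty-node chain ⟺ the Statement (the index-currency form of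
  gen 0's `realEdges_iff_cor312` and of A1's `soundAtPilot_iff_statement`); and the apex `summit_of_cor312_M_xi_f`: `ABC`
  from V, T, A, the multiradial estimate, and per curve the two side clauses, THE ONE STEP NODE `N_IUTchIII_Cor3_12_pf_xi_f`
  at the readings of record, and the two number identifications — kernel_hyps = 6 (hInd, hfin, hqpos, hxi_f, hΘ, hq), every
  one named, the disputed content displayed as ONE PRINTED NODE of the proof BY NAME. Nothing of Theorem 3.11, (IPL),
  [AbsAnab] Prop 1.2.1 (vii) or (SHE) is consumed on this path: those enter `lociReadingI_of_SHE` (granting the 85 LOCI), which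
  the nineteen discharged inferences do not need (an inference holds GIVEN its cited loci) and which (xi-f) — citing no locus
  (`Step.xi_f_data`) — cannot use. That is the kernel form of the cell's standing census: the printed proof's citations are
  all typed; its twenty inferences are bookkeeping but one; the one is the inequality.
THIS FILE PROVES NOTHING NEW about [IUTchIII] §3 AND ASSERTS NOTHING; no side taken on Cor. 3.12. typed ≠ discharged; indexed ≠
endorsed. [claim: Mochizuki2012, status: disputed]
-/

noncomputable section

namespace Summit.ABC.IUTFork.DAG

open Cor312Proof Thm311 PartC312k StepEarly StepMid StepX StepXI Literature.IUT.LogThetaLattice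

/-! ## 1. The observation reading of record -/

/-- **OBSERVATION READING OF RECORD** (TEAM A's readings at the loci reading of record; module docstring, first bullet). For
`S` a full situation, `P` a verbatim setting over it (column `P.n`, so the column data is `S.col P.n`), `D` a strips datum for
`P`'s lattice. Pass-through observations ↦ the conjunction of `lociReadingI S pending c` over the loci `c` their sentence cites
(TEAM A's wiring); (xi-f)'s `constitutesConstruction` ↦ the inclusion `↑(−|log(q)|) ≤ −|log(Θ)|` for `P`'s own quantities
(verbatim, volume level). A reading: recorded, not asserted. [claim: Mochizuki2012, status: disputed] -/
def obsReadingA {T : ThetaIndex} (S : FullSituation T) (pending : Locus → Prop) (P : Cor312.Setting S.toSituation)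
    (D : ThetaLinkStrips P.LogLink P.Strip) : Obs → Prop
  -- opening ¶ and (i): pass-throughs of Def 3.8 (i)/Rmk 3.9.5 (i), Def 3.8 (ii)/Def 2.4 (iii)/Rmk 3.8.1
  | .restrictToStrips => lociReadingI S pending .def3_8_i ∧ lociReadingI S pending .rem3_9_5_i
  | .linkSplits => lociReadingI S pending .def3_8_ii ∧ lociReadingI S pending .def2_4_iii
  | .valueGroupMapsPilots => lociReadingI S pending .def3_8_ii ∧ lociReadingI S pending .rem3_8_1
  -- (ii): the units are subject to exactly (Ind1), (Ind2) (real); cyclotomes insulated ← [EtTh], [IUTchI] Ex 5.1 (v), Def 5.2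
  | .unitsSubjectInd12 => UnitsInd12 S.toSituation
  | .cyclotomesInsulated => lociReadingI S pending .etTh ∧ lociReadingI S pending .chI_ex5_1_v ∧
      lociReadingI S pending .chI_def5_2
  -- (iii), (iv), (v)
  | .singleLinkNecessary => lociReadingI S pending .rem3_11_3
  | .verticalShiftSolved => ShiftInvariantAtInd3 P (S.col P.n)
  | .unitsRelatedContainers => lociReadingI S pending .thm1_5_iii ∧ lociReadingI S pending .thm1_5_iv
  | .frobeniusLikeRelatedToCoric => FrobToCoric P (S.col P.n)
  -- (vi)–(ix): provenance/method summaries, pass-throughs of the loci the sentences cite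
  | .logKummerViaGaloisEvaluation => lociReadingI S pending .chII_sec3_cor3_5_3_6 ∧ lociReadingI S pending .etTh
  | .conjSyncLogLinkCompatible => lociReadingI S pending .chII_prop4_2_i
  | .cycRigidityApproaches => CycRigThree (lociReadingI S pending .etTh) (lociReadingI S pending .absTopIII_prop3_2_iv)
      (lociReadingI S pending .absAnab_prop1_2_1_vii) (lociReadingI S pending .chII_rem3_6_4)
  | .symmetriesSeparate => lociReadingI S pending .chI_sec4_5_6
  | .symmetriesMultiradial => lociReadingI S pending .rem3_11_2
  | .conjugacyIndetResolved => lociReadingI S pending .chI_sec2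
  | .fmodTranslation => lociReadingI S pending .rem3_10_1 ∧ lociReadingI S pending .Ind3
  -- (x): TEAM A row A-1's real readings
  | .kummerDetachmentInd123 => KummerDetach P
  | .logvolInvariantInequality => LogvolCoarse P
  | .logvolLogLinkCompatible => LogvolLogLink P (S.col P.n)
  | .tensorIdentifiesMultZ => TensorMultZ P
  -- (xi-a)–(xi-c): row A-2's readings; (IPL) ↦ `S.link.IPL`, (SHE) ↦ `pending .SHE` through the loci reading of record
  | .linkAsGluing => LinkAsGluing P D (lociReadingI S pending .def3_8_ii ∧ lociReadingI S pending .rem3_8_1)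
  | .outputSatisfiesIPLSHE => OutputIPLSHE (lociReadingI S pending .IPL) (lociReadingI S pending .SHE)
  | .valueGroupLinkFullPolyIso => ValueGroupFullPoly P D
  | .onlyQualitative => OnlyQualitative
  | .displayXIc => DisplayXIc P D (lociReadingI S pending .IPL) (lociReadingI S pending .SHE)
  | .hullGivesVectorBundles => HullComparable P
  -- (xi-d), (xi-e): row A-3's real readings (abc-iut-c312-4)
  | .displayXId => P.DisplayXIdReal
  | .comparableObjects => P.ComparableObjectsReal
  | .degreesAsLogVolumes => P.DegreesAsLogVolumesReal
  | .oneColumnLogKummerRectifies => P.OneColumnLogKummerReal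
  | .sheMeansFixedValue => P.SheMeansFixedValueReal
  | .displayXIe => P.DisplayXIeReal
  -- (xi-f): THE DISPUTED OBSERVATION, verbatim at volume level: `−|log(q)| ∈ ℝ_{≤ −|log(Θ)|}` for the setting's own quantities
  | .constitutesConstruction => ((P.negLogQ : ℝ) : WithTop ℝ) ≤ P.negLogTheta
  -- (xi-g): pass-through of what it invokes (the Thm-3.11 algorithm locus and (xi-f)'s observation)
  | .twoEquivalentWays => lociReadingI S pending .thm3_11_algo ∧ ((P.negLogQ : ℝ) : WithTop ℝ) ≤ P.negLogTheta
  -- (xi-h): the kernel fact of file IV (the `N = 2` analogue is not formal); (xii): the one locus it cites, Rmk 3.6.2 (i)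
  | .noNthPower => ∃ V : Volumes, V.Cor312 ∧ V.negLogTheta = ((-1 : ℝ) : WithTop ℝ) ∧ ¬ (V.negAbsLogq ≤ 2 * (-1))
  | .globalFrobenioidsNeeded => lociReadingI S pending .rem3_6_2_i

variable {T : ThetaIndex} (S : FullSituation T) (pending : Locus → Prop) (P : Cor312.Setting S.toSituation)
  (D : ThetaLinkStrips P.LogLink P.Strip)

/-- The disputed observation is read as the inclusion of the setting's two quantities. [folklore] -/
theorem obsReadingA_constitutesConstruction :
    obsReadingA S pending P D .constitutesConstruction = (((P.negLogQ : ℝ) : WithTop ℝ) ≤ P.negLogTheta) := rfl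
/-- (xi-b)'s "(IPL) ∧ (SHE)" is read through the loci reading of record: `S.link.IPL ∧ pending .SHE`. [folklore] -/
theorem obsReadingA_outputSatisfiesIPLSHE :
    obsReadingA S pending P D .outputSatisfiesIPLSHE = OutputIPLSHE S.link.IPL (pending .SHE) := rfl
/-- The six (xi-d)/(xi-e) observations agree with abc-iut-c312-4's real readings, definitionally. [folklore] -/
theorem agreesXIde_obsReadingA : P.AgreesXIde (obsReadingA S pending P D) :=
  ⟨Iff.rfl, Iff.rfl, Iff.rfl, Iff.rfl, Iff.rfl, Iff.rfl⟩

/-- The loci reading of record at Thm 3.11 (ii)(a): `KummerA` of every column (part f, through the fall-throughs). [folklore] -/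
theorem lociReadingI_thm3_11_ii_a_iff : lociReadingI S pending .thm3_11_ii_a ↔ ∀ n : ℤ, (S.col n).KummerA (S.D n) := Iff.rfl
/-- … at Thm 3.11 (ii)(b): `KummerB` of every column. [folklore] -/
theorem lociReadingI_thm3_11_ii_b_iff : lociReadingI S pending .thm3_11_ii_b ↔ ∀ n : ℤ, (S.col n).KummerB (S.D n) := Iff.rfl
/-- … at Thm 3.11 (ii)(c): `KummerC` of every column. [folklore] -/
theorem lociReadingI_thm3_11_ii_c_iff : lociReadingI S pending .thm3_11_ii_c ↔ ∀ n : ℤ, (S.col n).KummerC (S.D n) := Iff.rfl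
/-- … at (Ind3): the (Ind3) containments of every column. [folklore] -/
theorem lociReadingI_Ind3_iff : lociReadingI S pending .Ind3 ↔ ∀ n : ℤ, (S.col n).Ind3 (S.D n) := Iff.rfl

/-! ## 2. Sixteen step nodes discharged outright under the readings of record -/

/-- opening ¶ DISCHARGED under the readings of record (TEAM A `stepWlog_holds`, identity wires). [folklore] -/
theorem N_IUTchIII_Cor3_12_pf_WLOG_holds :
    N_IUTchIII_Cor3_12_pf_WLOG (lociReadingI S pending) (obsReadingA S pending P D) :=
  stepWlog_holds (L := lociReadingI S pending) (O := obsReadingA S pending P D) (CRestrict := obsReadingA S pending P D .restrictToStrips) And.intro id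
/-- Step (i) DISCHARGED under the readings of record (`stepI_holds`). [folklore] -/
theorem N_IUTchIII_Cor3_12_pf_i_holds : N_IUTchIII_Cor3_12_pf_i (lociReadingI S pending) (obsReadingA S pending P D) :=
  stepI_holds (L := lociReadingI S pending) (O := obsReadingA S pending P D) (CSplit := obsReadingA S pending P D .linkSplits) (CVG := obsReadingA S pending P D .valueGroupMapsPilots)
    And.intro And.intro id id
/-- Step (ii) DISCHARGED under the readings of record (`stepII_holds`; `unitsInd12_holds` inside). [folklore] -/
theorem N_IUTchIII_Cor3_12_pf_ii_holds : N_IUTchIII_Cor3_12_pf_ii (lociReadingI S pending) (obsReadingA S pending P D) :=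
  stepII_holds (L := lociReadingI S pending) (O := obsReadingA S pending P D) (CIns := obsReadingA S pending P D .cyclotomesInsulated) (fun a b c => ⟨a, b, c⟩) id id
/-- Step (iii) DISCHARGED under the readings of record (`stepIII_holds`). [folklore] -/
theorem N_IUTchIII_Cor3_12_pf_iii_holds : N_IUTchIII_Cor3_12_pf_iii (lociReadingI S pending) (obsReadingA S pending P D) :=
  stepIII_holds (L := lociReadingI S pending) (O := obsReadingA S pending P D) (CNonComm := obsReadingA S pending P D .singleLinkNecessary) id id
/-- Step (iv) DISCHARGED under the readings of record (`stepIV_holds` at the column `S.col P.n`: Thm 3.11 (ii)(b)(c) and (Ind3)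
are READ through the situation, so the wires are evaluation at `P.n`; `Column.mutualCompat_of_kummerB_kummerC` inside). [folklore] -/
theorem N_IUTchIII_Cor3_12_pf_iv_holds : N_IUTchIII_Cor3_12_pf_iv (lociReadingI S pending) (obsReadingA S pending P D) :=
  stepIV_holds P (S.col P.n) (L := lociReadingI S pending) (O := obsReadingA S pending P D)
    (fun h => (lociReadingI_thm3_11_ii_b_iff S pending).1 h P.n) (fun h => (lociReadingI_thm3_11_ii_c_iff S pending).1 h P.n)
    (fun h => (lociReadingI_Ind3_iff S pending).1 h P.n) id
/-- Step (v) DISCHARGED under the readings of record (`stepV_holds` at the column `S.col P.n`). [folklore] -/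
theorem N_IUTchIII_Cor3_12_pf_v_holds : N_IUTchIII_Cor3_12_pf_v (lociReadingI S pending) (obsReadingA S pending P D) :=
  stepV_holds P (S.col P.n) (L := lociReadingI S pending) (O := obsReadingA S pending P D) (CBiCoric := obsReadingA S pending P D .unitsRelatedContainers)
    And.intro (fun h => (lociReadingI_thm3_11_ii_a_iff S pending).1 h P.n) (fun h => (lociReadingI_thm3_11_ii_b_iff S pending).1 h P.n)
    (fun h => (lociReadingI_thm3_11_ii_c_iff S pending).1 h P.n) id id
/-- Step (vi) DISCHARGED under the readings of record (`stepVI_holds`; the two L4 pins and [EtTh] enter `CycRigThree` as their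
reading-of-record values — [AbsAnab] Prop 1.2.1 (vii) ↦ `galoisMLF_iso_residueMap`, [EtTh] ↦ its landed claim nodes). [folklore] -/
theorem N_IUTchIII_Cor3_12_pf_vi_holds : N_IUTchIII_Cor3_12_pf_vi (lociReadingI S pending) (obsReadingA S pending P D) :=
  stepVI_holds (L := lociReadingI S pending) (O := obsReadingA S pending P D) (CGalEval := obsReadingA S pending P D .logKummerViaGaloisEvaluation)
    (CConjSync := obsReadingA S pending P D .conjSyncLogLinkCompatible)
    (CMono := lociReadingI S pending .etTh) (CMLF := lociReadingI S pending .absTopIII_prop3_2_iv)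
    (CNF := lociReadingI S pending .absAnab_prop1_2_1_vii) (CCompat := lociReadingI S pending .chII_rem3_6_4)
    And.intro id id id id id id id id
/-- Step (vii) DISCHARGED under the readings of record (`stepVII_holds`). [folklore] -/
theorem N_IUTchIII_Cor3_12_pf_vii_holds : N_IUTchIII_Cor3_12_pf_vii (lociReadingI S pending) (obsReadingA S pending P D) :=
  stepVII_holds (L := lociReadingI S pending) (O := obsReadingA S pending P D) (CSep := lociReadingI S pending .chI_sec4_5_6) (CTaut := lociReadingI S pending .rem3_11_2) id id id id
/-- Step (viii) DISCHARGED under the readings of record (`stepVIII_holds`). [folklore] -/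
theorem N_IUTchIII_Cor3_12_pf_viii_holds :
    N_IUTchIII_Cor3_12_pf_viii (lociReadingI S pending) (obsReadingA S pending P D) :=
  stepVIII_holds (L := lociReadingI S pending) (O := obsReadingA S pending P D) (CConjRes := lociReadingI S pending .chI_sec2) id id
/-- Step (ix) DISCHARGED under the readings of record (`stepIX_holds`). [folklore] -/
theorem N_IUTchIII_Cor3_12_pf_ix_holds : N_IUTchIII_Cor3_12_pf_ix (lociReadingI S pending) (obsReadingA S pending P D) :=
  stepIX_holds (L := lociReadingI S pending) (O := obsReadingA S pending P D) (CFmod := obsReadingA S pending P D .fmodTranslation) And.intro id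
/-- Step (xi-b) DISCHARGED under the readings of record (`stepXIb_holds`: (IPL)/(SHE) pass through the loci reading — `S.link.IPL`,
`pending .SHE` —; `valueGroupFullPoly_holds` and `onlyQualitative_holds` inside). [folklore] -/
theorem N_IUTchIII_Cor3_12_pf_xi_b_holds :
    N_IUTchIII_Cor3_12_pf_xi_b (lociReadingI S pending) (obsReadingA S pending P D) :=
  stepXIb_holds P D (L := lociReadingI S pending) (O := obsReadingA S pending P D) (CIPL := lociReadingI S pending .IPL) (CSHE := lociReadingI S pending .SHE) id id id id id
/-- Step (xi-c) DISCHARGED under the readings of record (`stepXIc_holds`; `hullComparable_holds` inside). [folklore] -/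
theorem N_IUTchIII_Cor3_12_pf_xi_c_holds :
    N_IUTchIII_Cor3_12_pf_xi_c (lociReadingI S pending) (obsReadingA S pending P D) :=
  stepXIc_holds P D (L := lociReadingI S pending) (O := obsReadingA S pending P D) (CIPL := lociReadingI S pending .IPL) (CSHE := lociReadingI S pending .SHE) id id id
/-- Step (xi-e) DISCHARGED under the readings of record (abc-iut-c312-4's `stepXIe_holds`: the (SHE)-as-fixed-value reading is a
theorem, `sheMeansFixedValueReal_holds`). [folklore] -/
theorem N_IUTchIII_Cor3_12_pf_xi_e_holds :
    N_IUTchIII_Cor3_12_pf_xi_e (lociReadingI S pending) (obsReadingA S pending P D) :=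
  Cor312.Setting.stepXIe_holds (agreesXIde_obsReadingA S pending P D) _
/-- Step (xi-g) DISCHARGED under the readings of record (A1's `xi_g_holds_iff`: the node is the pass-through of what it invokes).
[folklore] -/
theorem N_IUTchIII_Cor3_12_pf_xi_g_holds :
    N_IUTchIII_Cor3_12_pf_xi_g (lociReadingI S pending) (obsReadingA S pending P D) :=
  (xi_g_holds_iff (L := lociReadingI S pending) (O := obsReadingA S pending P D)).2 And.intro
/-- Step (xi-h) DISCHARGED under the readings of record (A1's `xi_h_holds_nthPower` on gen 0's kernel fact `nthPower_not_formal`).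
[folklore] -/
theorem N_IUTchIII_Cor3_12_pf_xi_h_holds :
    N_IUTchIII_Cor3_12_pf_xi_h (lociReadingI S pending) (obsReadingA S pending P D) :=
  xi_h_holds_nthPower (L := lociReadingI S pending) (O := obsReadingA S pending P D) Iff.rfl
/-- Step (xii) DISCHARGED under the readings of record: its terminal observation is read as the value of the one locus it cites
(Rmk 3.6.2 (i)), so the node is `hc ↦ hc`. [folklore] -/
theorem N_IUTchIII_Cor3_12_pf_xii_holds :
    N_IUTchIII_Cor3_12_pf_xii (lociReadingI S pending) (obsReadingA S pending P D) := by
  intro hc _ o ho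
  have ho' : o = Obs.globalFrobenioidsNeeded := by simpa [Step.concl, Step.data] using ho
  subst ho'
  exact hc .rem3_6_2_i (by decide)

/-! ## 3. Three step nodes under named side data of the instantiation -/

/-- Step (x) under the readings of record GIVEN the three coarse-space properties of the line's data `S.D P.n` — admissibility
invariance on the (Ind1)/(Ind2) generators, `LogvolInvariant`, monotonicity (TEAM B rows B-2/B-4 for the real containers) —
(`stepX_holds` at the column `S.col P.n`; Thm 3.11 (ii)(a) is READ through the situation, wire = evaluation at `P.n`;
`kummerDetach_holds`, `logvolCoarse_of_generators`, `logvolLogLink_of_kummerA`, `tensorMultZ_holds` inside). [folklore] -/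
theorem N_IUTchIII_Cor3_12_pf_x_holds_of
    (hIndAdm : ∀ Φ ∈ S.L.Ind1Family ∪ S.L.Ind2Family, ∀ (j : T.Label) (vQ : T.VQ) (A : Set (S.L.Packet j vQ)),
      (S.D P.n).Adm j vQ A ↔ (S.D P.n).Adm j vQ (Φ j vQ '' A))
    (hIndVol : (S.D P.n).LogvolInvariant)
    (hMono : ∀ (j : T.Label) (vQ : T.VQ) (A B : Set (S.L.Packet j vQ)),
      (S.D P.n).Adm j vQ A → (S.D P.n).Adm j vQ B → A ⊆ B → (S.D P.n).logvol j vQ A ≤ (S.D P.n).logvol j vQ B) :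
    N_IUTchIII_Cor3_12_pf_x (lociReadingI S pending) (obsReadingA S pending P D) :=
  stepX_holds P (S.col P.n) (L := lociReadingI S pending) (O := obsReadingA S pending P D) (fun _ _ => hIndAdm) (fun _ _ _ => hIndVol)
    (fun _ => hMono) (fun h => (lociReadingI_thm3_11_ii_a_iff S pending).1 h P.n) id id id id

/-- Step (xi-a) under the readings of record GIVEN the nonemptiness of the strip isomorphisms at every lattice position (Def. 3.8
(ii)'s presupposition; abc-iut-L6-t2's real instances) (`stepXIa_holds`). [folklore] -/
theorem N_IUTchIII_Cor3_12_pf_xi_a_holds_of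
    (hNE : ∀ n m : ℤ, Nonempty (P.IsoS (D.stripLGP (P.lattice.logLink n (m - 1))) (D.stripDelta (P.lattice.theater (n + 1) m)))) :
    N_IUTchIII_Cor3_12_pf_xi_a (lociReadingI S pending) (obsReadingA S pending P D) :=
  stepXIa_holds P D (L := lociReadingI S pending) (O := obsReadingA S pending P D) (VG := obsReadingA S pending P D .valueGroupMapsPilots) id hNE id

/-- Step (xi-d) under the readings of record GIVEN the Statement's own side clauses `ThetaFinite` and `AbsLogQPos`
(abc-iut-c312-4's `stepXId_holds_of`; the clauses are NECESSARY there, `thetaFinite_of_comparableObjects`). [folklore] -/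
theorem N_IUTchIII_Cor3_12_pf_xi_d_holds_of (hfin : P.ThetaFinite) (hqpos : P.AbsLogQPos) :
    N_IUTchIII_Cor3_12_pf_xi_d (lociReadingI S pending) (obsReadingA S pending P D) :=
  Cor312.Setting.stepXId_holds_of (agreesXIde_obsReadingA S pending P D) hfin hqpos _

/-! ## 4. The one node left: (xi-f) under the readings of record is the Corollary -/

/-- (xi-f) under the readings of record, SOLVED (A1's `xi_f_holds_iff`): the node is exactly "`(xi-e)`'s display ⟹
(SHE)-as-fixed-value ⟹ `↑(−|log(q)|) ≤ −|log(Θ)|`" for the setting's real readings. [claim: Mochizuki2012, status: disputed] -/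
theorem N_IUTchIII_Cor3_12_pf_xi_f_iff :
    N_IUTchIII_Cor3_12_pf_xi_f (lociReadingI S pending) (obsReadingA S pending P D) ↔
      (P.DisplayXIeReal → P.SheMeansFixedValueReal → ((P.negLogQ : ℝ) : WithTop ℝ) ≤ P.negLogTheta) :=
  xi_f_holds_iff (L := lociReadingI S pending) (O := obsReadingA S pending P D)

/-- **THE ONE NODE LEFT IS THE COROLLARY.** Given the two side clauses of the Statement (`ThetaFinite`: "`−|log(Θ)| ∈ ℝ`";
`AbsLogQPos`: "`|log(q)| > 0`"), the (xi-f) node under the readings of record is EQUIVALENT to [IUTchIII] Cor. 3.12 as typed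
(`Cor312.Setting.Statement`). TEAM A's LEVEL 0 in the index's currency; no side taken. [claim: Mochizuki2012, status: disputed] -/
theorem N_IUTchIII_Cor3_12_pf_xi_f_iff_statement (hfin : P.ThetaFinite) (hqpos : P.AbsLogQPos) :
    N_IUTchIII_Cor3_12_pf_xi_f (lociReadingI S pending) (obsReadingA S pending P D) ↔ P.Statement := by
  rw [N_IUTchIII_Cor3_12_pf_xi_f_iff]
  have hdisp : P.DisplayXIeReal := P.displayXIeReal_of_comparableObjectsReal (P.comparableObjectsReal_iff.2 ⟨hfin, hqpos⟩)
  have hne : P.negLogTheta ≠ ⊤ := P.negLogTheta_ne_top_iff.2 hfin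
  exact ⟨fun h => ⟨hne, h hdisp P.sheMeansFixedValueReal_holds⟩, fun h _ _ => h.2⟩

/-! ## 5. The chain under the readings of record, and the apex -/

/-- **THE TWENTY-NODE CHAIN UNDER THE READINGS OF RECORD** from the named side data and THE ONE NODE (xi-f): nineteen nodes by
§§2–3, (xi-f) by hypothesis, BY NAME. [claim: Mochizuki2012, status: disputed] -/
theorem chain_of_record
    (hIndAdm : ∀ Φ ∈ S.L.Ind1Family ∪ S.L.Ind2Family, ∀ (j : T.Label) (vQ : T.VQ) (A : Set (S.L.Packet j vQ)),
      (S.D P.n).Adm j vQ A ↔ (S.D P.n).Adm j vQ (Φ j vQ '' A))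
    (hIndVol : (S.D P.n).LogvolInvariant)
    (hMono : ∀ (j : T.Label) (vQ : T.VQ) (A B : Set (S.L.Packet j vQ)),
      (S.D P.n).Adm j vQ A → (S.D P.n).Adm j vQ B → A ⊆ B → (S.D P.n).logvol j vQ A ≤ (S.D P.n).logvol j vQ B)
    (hNE : ∀ n m : ℤ, Nonempty (P.IsoS (D.stripLGP (P.lattice.logLink n (m - 1))) (D.stripDelta (P.lattice.theater (n + 1) m))))
    (hfin : P.ThetaFinite) (hqpos : P.AbsLogQPos)
    (hxi_f : N_IUTchIII_Cor3_12_pf_xi_f (lociReadingI S pending) (obsReadingA S pending P D)) :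
    N_IUTchIII_Cor3_12_pf (lociReadingI S pending) (obsReadingA S pending P D) := by
  intro s
  cases s
  case wlog => exact N_IUTchIII_Cor3_12_pf_WLOG_holds S pending P D
  case i => exact N_IUTchIII_Cor3_12_pf_i_holds S pending P D
  case ii => exact N_IUTchIII_Cor3_12_pf_ii_holds S pending P D
  case iii => exact N_IUTchIII_Cor3_12_pf_iii_holds S pending P D
  case iv => exact N_IUTchIII_Cor3_12_pf_iv_holds S pending P D
  case v => exact N_IUTchIII_Cor3_12_pf_v_holds S pending P D
  case vi => exact N_IUTchIII_Cor3_12_pf_vi_holds S pending P D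
  case vii => exact N_IUTchIII_Cor3_12_pf_vii_holds S pending P D
  case viii => exact N_IUTchIII_Cor3_12_pf_viii_holds S pending P D
  case ix => exact N_IUTchIII_Cor3_12_pf_ix_holds S pending P D
  case x => exact N_IUTchIII_Cor3_12_pf_x_holds_of S pending P D hIndAdm hIndVol hMono
  case xi_a => exact N_IUTchIII_Cor3_12_pf_xi_a_holds_of S pending P D hNE
  case xi_b => exact N_IUTchIII_Cor3_12_pf_xi_b_holds S pending P D
  case xi_c => exact N_IUTchIII_Cor3_12_pf_xi_c_holds S pending P D
  case xi_d => exact N_IUTchIII_Cor3_12_pf_xi_d_holds_of S pending P D hfin hqpos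
  case xi_e => exact N_IUTchIII_Cor3_12_pf_xi_e_holds S pending P D
  case xi_f => exact hxi_f
  case xi_g => exact N_IUTchIII_Cor3_12_pf_xi_g_holds S pending P D
  case xi_h => exact N_IUTchIII_Cor3_12_pf_xi_h_holds S pending P D
  case xii => exact N_IUTchIII_Cor3_12_pf_xii_holds S pending P D

/-- **UNDER THE READINGS OF RECORD AND THE NAMED SIDE DATA, THE TWENTY-NODE CHAIN ⟺ THE COROLLARY AS TYPED.** The index-currency
form of gen 0's `realEdges_iff_cor312` and of A1's `soundAtPilot_iff_statement`: granting the side data, the printed proof's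
twenty inferences carry exactly the Statement — nineteen are theorems, one is it. No side taken. [claim: Mochizuki2012, status: disputed] -/
theorem chain_of_record_iff_statement
    (hIndAdm : ∀ Φ ∈ S.L.Ind1Family ∪ S.L.Ind2Family, ∀ (j : T.Label) (vQ : T.VQ) (A : Set (S.L.Packet j vQ)),
      (S.D P.n).Adm j vQ A ↔ (S.D P.n).Adm j vQ (Φ j vQ '' A))
    (hIndVol : (S.D P.n).LogvolInvariant)
    (hMono : ∀ (j : T.Label) (vQ : T.VQ) (A B : Set (S.L.Packet j vQ)),
      (S.D P.n).Adm j vQ A → (S.D P.n).Adm j vQ B → A ⊆ B → (S.D P.n).logvol j vQ A ≤ (S.D P.n).logvol j vQ B)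
    (hNE : ∀ n m : ℤ, Nonempty (P.IsoS (D.stripLGP (P.lattice.logLink n (m - 1))) (D.stripDelta (P.lattice.theater (n + 1) m))))
    (hfin : P.ThetaFinite) (hqpos : P.AbsLogQPos) :
    N_IUTchIII_Cor3_12_pf (lociReadingI S pending) (obsReadingA S pending P D) ↔ P.Statement := by
  rw [← N_IUTchIII_Cor3_12_pf_xi_f_iff_statement S pending P D hfin hqpos]
  exact ⟨fun h => h .xi_f, chain_of_record S pending P D hIndAdm hIndVol hMono hNE hfin hqpos⟩

/-- **APEX, THE DISPUTED CONTENT AS ONE PRINTED NODE BY NAME.** `ABC` from V, T, A, the multiradial estimate (`hInd`), and per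
curve: a full situation with a verbatim setting and strips datum, the Statement's two side clauses (`hfin`, `hqpos`), THE STEP
NODE (xi-f) of the proof of Cor. 3.12 under the readings of record (`hxi_f`), and the two number identifications (`hΘ`, `hq`).
kernel_hyps = 6 (hInd, hfin, hqpos, hxi_f, hΘ, hq) — none opaque, none a reading binder, one a printed node by name. Theorem 3.11
as typed, (IPL), [AbsAnab] Prop 1.2.1 (vii), (SHE) are NOT consumed on this path (they grant LOCI; (xi-f) cites none,
`Step.xi_f_data`). [claim: Mochizuki2012, status: disputed] -/
theorem summit_of_cor312_M_xi_f (V : HeightFamily) (Tm : Thm110Family V) (A : AbcDictionary V)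
    (hInd : MochizukiIndeterminacies Tm) {TI : V.Pt → ThetaIndex} (S : ∀ P, FullSituation (TI P)) (pending : Locus → Prop)
    (Pv : ∀ P, Cor312.Setting (S P).toSituation) (Dk : ∀ P, ThetaLinkStrips (Pv P).LogLink (Pv P).Strip)
    (hfin : ∀ P, (Pv P).ThetaFinite) (hqpos : ∀ P, (Pv P).AbsLogQPos)
    (hxi_f : ∀ P, N_IUTchIII_Cor3_12_pf_xi_f (lociReadingI (S P) pending) (obsReadingA (S P) pending (Pv P) (Dk P)))
    (hΘ : ∀ P, (Pv P).negLogTheta = (((Tm.X P).negLogTheta : ℝ) : WithTop ℝ)) (hq : ∀ P, (Pv P).negLogQ = -(Tm.X P).absLogq) :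
    _root_.ABC :=
  abc_of_indeterminacies_of_cor312 V Tm A hInd fun P => by
    unfold Thm110Data.Cor312
    have hs : (Pv P).Statement := (N_IUTchIII_Cor3_12_pf_xi_f_iff_statement (S P) pending (Pv P) (Dk P) (hfin P) (hqpos P)).1 (hxi_f P)
    have h2 := hs.2
    rw [hΘ, hq, WithTop.coe_le_coe] at h2
    exact h2

/-- CENSUS after Δ7 (by `decide` over the landed citation DAG, plus arithmetic): of the twenty step nodes, sixteen are discharged
outright under the readings of record, three under named side data of the instantiation, one — (xi-f), the node citing NO locus —
is left and is the Statement; the header (xi) is the conjunction of its eight substeps. [folklore] -/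
theorem step_census_v7 : (16 : ℕ) + 3 + 1 = 20 ∧ Step.all.length = 20 ∧ Step.xi_f.cites = [] ∧
    (Step.all.filter fun s => decide (s.cites = [])) = [.xi_f] := by
  refine ⟨rfl, ?_, ?_, ?_⟩ <;> decide

end Summit.ABC.IUTFork.DAG

end
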